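import Summits.CriticalPhenomena.PercolationContinuityZ3.Theorems.PercNearOneGluingNearOneGluingCondDisconnTilt
import Summits.CriticalPhenomena.PercolationContinuityZ3.Theorems.PercNearOneGluingAdditiveGluingKnThm2GoodEvents

/-!
# Crux `PercNearOneGluing.NearOneGluing` (stmt-CriticalPhenomena-4574), line `SketchR2I5` —
# the exchange slack S2 from its sharp form S2_M

Lead prover-line-stmt-CriticalPhenomena-4574-c7 (cycle 7, wave 3).  Lands `--supports stmt-CriticalPhenomena-4574`;
no definitions, no named facts.

## Content

Finite weighted graph on `Fin n`, `μ = prodBernoulli w`, `{u ↔ v} = openConn u v`.  Notation: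
`D := {y ↮ z}`, `D_a := {x ↮ y} ∩ {x ↮ z}`, `W := D_a ∩ {o ↔ x}`, `N := {x ↮ y} ∩ {x ↮ z} ∩ {y ↮ z}`
(the three relays pairwise separated), and for an event `Q`
`τ(Q) := μ(D)·μ(Q ∩ {z ↮ b} ∩ D) − μ(Q ∩ D)·μ({z ↮ b} ∩ D)` (`= μ(D)²·Cov(1_Q, 1{z↮b} | D)`; it equals the
registered `σ₂(Q) = μ(Q ∩ D)μ({z↔b} ∩ D) − μ(D)μ(Q ∩ {z↔b} ∩ D)`).

The registered open stub `stub_exchS2` reads `μ(W)·σ₂({x↔y}) ≤ μ(D_a)·σ₂({o↔y})`, i.e.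
`Cov_D(1{o↔y}, 1{z↮b}) ≥ θ·Cov_D(1{x↔y}, 1{z↮b})` with `θ = μ(W)/μ(D_a) = P(o↔x | x↮y, x↮z)`.
The wave-1 analysis (worker report ExchS2.md, crux NOTES §H) showed that the sharp constant is
`θ_M := P(o ↔ x | N) ≥ θ`; the corresponding statement S2_M (registered as `stub_s2M`,
`μ({o↔x} ∩ N)·τ({x↔y}) ≤ μ(N)·τ({o↔y})`, 0 violations in 13 000 exact instances) is the honest residual.
This file proves the REDUCTION

  `S2_M ⟹ stub_exchS2`     (`exchS2_of_s2M`, and the registered-signature form `stub_exchS2_of_stub_s2M`),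

from three tree facts: (i) the conditional-disconnection tilt `condDisconnTilt` (lead c7 wave 2, p169095):
`θ ≤ θ_M`, i.e. `μ(W)·μ(N) ≤ μ({o↔x} ∩ N)·μ(D_a)`; (ii) van den Berg–Häggström–Kahn Thm. 1.4
(`knLemma3i_twoCluster`): `τ({x↔y}) ≥ 0` (the clusters of `y` and `z` are negatively correlated given `y ↮ z`);
(iii) Harris' inequality for the two decreasing events `D_a`, `D`: `μ(N) ≥ μ(D_a)·μ(D)`, which disposes of the
degenerate case `μ(N) = 0`.
[cite: VandenbergHaggstromKahn2005, Thm. 1.4 (p. 7)] [cite: KozmaNitzan2024, Question 7 (p. 36)]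
-/

namespace Summit.CriticalPhenomena.PercolationContinuityZ3.Theorems

open MeasureTheory Set Literature.Probability.LatticeModels Literature.Probability.Percolation
open scoped Classical
open Q7ThreeCut

noncomputable section

variable {n : ℕ}

/-- The avoidance event `{∀ q ∈ {y,z}, x ↮ q}` is `{x ↮ y} ∩ {x ↮ z}`. [folklore] -/
theorem s2red_avoid_pair_eq (x y z : Fin n) :
    {ω : BondConfig (Fin n) | ∀ q ∈ ({y, z} : Finset (Fin n)), ω ∉ (openConn x q : Set (BondConfig (Fin n)))} =
      (openConn x y)ᶜ ∩ (openConn x z)ᶜ := by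
  ext ω
  simp only [Finset.mem_insert, Finset.mem_singleton, forall_eq_or_imp, forall_eq, mem_setOf_eq,
    mem_inter_iff, mem_compl_iff]

/-- **θ ≤ θ_M** (denominator-free): `μ(W)·μ(N) ≤ μ({o↔x} ∩ N)·μ(D_a)` — the conditional-disconnection tilt
`condDisconnTilt` with source `x`, avoided set `{y,z}`, target `o` and disconnection `{y ↮ z}`. [folklore] -/
theorem s2red_theta_le_thetaM (w : Sym2 (Fin n) → unitInterval) (o x y z : Fin n) :
    (prodBernoulli w).real (((openConn x y)ᶜ ∩ (openConn x z)ᶜ) ∩ openConn o x) *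
        (prodBernoulli w).real ((openConn x y)ᶜ ∩ (openConn x z)ᶜ ∩ (openConn y z)ᶜ) ≤
      (prodBernoulli w).real (openConn o x ∩ ((openConn x y)ᶜ ∩ (openConn x z)ᶜ ∩ (openConn y z)ᶜ)) *
        (prodBernoulli w).real ((openConn x y)ᶜ ∩ (openConn x z)ᶜ) := by
  have h := condDisconnTilt w ({y, z} : Finset (Fin n)) x o y z (by simp)
  rw [s2red_avoid_pair_eq x y z, knThm2_openConn_comm x o] at h
  have e1 : ((openConn x y)ᶜ ∩ (openConn x z)ᶜ ∩ (openConn y z)ᶜ : Set (BondConfig (Fin n))) =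
      (openConn x y)ᶜ ∩ (openConn x z)ᶜ ∩ (openConn y z)ᶜ := rfl
  have e2 : ((openConn x y)ᶜ ∩ (openConn x z)ᶜ ∩ openConn o x ∩ (openConn y z)ᶜ : Set (BondConfig (Fin n))) =
      openConn o x ∩ ((openConn x y)ᶜ ∩ (openConn x z)ᶜ ∩ (openConn y z)ᶜ) := by
    ext ω; simp only [mem_inter_iff, mem_compl_iff]; tauto
  rw [e2] at h
  exact h

/-- **τ({x↔y}) ≥ 0**: `μ({x↔y} ∩ D)·μ({z↮b} ∩ D) ≤ μ(D)·μ({x↔y} ∩ {z↮b} ∩ D)` for `D = {y ↮ z}` — the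
clusters of `z` and `y` are negatively correlated given `y ↮ z` (BHK Thm. 1.4, `knLemma3i_twoCluster`
with `f = 1{z↔b}`, `g = 1{x∈C_y}`), rewritten for the complement `{z ↮ b}`.
[cite: VandenbergHaggstromKahn2005, Thm. 1.4 (p. 7)] -/
theorem s2red_tau_nonneg (w : Sym2 (Fin n) → unitInterval) (b x y z : Fin n) (hyz : y ≠ z) :
    (prodBernoulli w).real (openConn x y ∩ (openConn y z)ᶜ) *
        (prodBernoulli w).real ((openConn z b)ᶜ ∩ (openConn y z)ᶜ) ≤
      (prodBernoulli w).real (openConn y z)ᶜ *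
        (prodBernoulli w).real (openConn x y ∩ (openConn z b)ᶜ ∩ (openConn y z)ᶜ) := by
  set μ := prodBernoulli w with hμ
  -- BHK 1.4: source `z`, second cluster `y`, `Q = {y ↔ x}` increasing in `C_y`
  have bhk := knLemma3i_twoCluster w z y b (openConn y x) (pivDom_openConn_mono_openEdgeCluster y x) hyz.symm
  rw [knThm2_openConn_comm z y, ← knThm2_openConn_comm x y] at bhk
  -- complements inside `D`
  have hm : ∀ s : Set (BondConfig (Fin n)), MeasurableSet s := fun _ => MeasurableSet.of_discrete
  have c1 : μ.real ((openConn y z)ᶜ ∩ openConn z b : Set (BondConfig (Fin n))) +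
      μ.real ((openConn z b)ᶜ ∩ (openConn y z)ᶜ : Set (BondConfig (Fin n))) =
        μ.real ((openConn y z)ᶜ : Set (BondConfig (Fin n))) := by
    have h := measureReal_inter_add_sdiff (μ := μ) (s := ((openConn y z)ᶜ : Set (BondConfig (Fin n))))
      (t := openConn z b) (hm _)
    have hs : ((openConn y z)ᶜ : Set (BondConfig (Fin n))) \ openConn z b = (openConn z b)ᶜ ∩ (openConn y z)ᶜ := by
      ext ω; simp only [mem_sdiff, mem_compl_iff, mem_inter_iff]; tauto
    rw [hs] at h; exact h
  have c2 : μ.real ((openConn y z)ᶜ ∩ (openConn z b ∩ openConn x y) : Set (BondConfig (Fin n))) +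
      μ.real (openConn x y ∩ (openConn z b)ᶜ ∩ (openConn y z)ᶜ : Set (BondConfig (Fin n))) =
        μ.real (openConn x y ∩ (openConn y z)ᶜ : Set (BondConfig (Fin n))) := by
    have h := measureReal_inter_add_sdiff (μ := μ) (s := (openConn x y ∩ (openConn y z)ᶜ : Set (BondConfig (Fin n))))
      (t := openConn z b) (hm _)
    have hs1 : (openConn x y ∩ (openConn y z)ᶜ : Set (BondConfig (Fin n))) ∩ openConn z b =
        (openConn y z)ᶜ ∩ (openConn z b ∩ openConn x y) := by
      ext ω; simp only [mem_inter_iff, mem_compl_iff]; tauto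
    have hs2 : (openConn x y ∩ (openConn y z)ᶜ : Set (BondConfig (Fin n))) \ openConn z b =
        openConn x y ∩ (openConn z b)ᶜ ∩ (openConn y z)ᶜ := by
      ext ω; simp only [mem_sdiff, mem_inter_iff, mem_compl_iff]; tauto
    rw [hs1, hs2] at h; exact h
  have c3 : ((openConn y z)ᶜ ∩ openConn x y : Set (BondConfig (Fin n))) = openConn x y ∩ (openConn y z)ᶜ :=
    inter_comm _ _
  rw [c3] at bhk
  nlinarith [bhk, c1, c2, measureReal_nonneg (μ := μ) (s := ((openConn y z)ᶜ : Set (BondConfig (Fin n)))),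
    measureReal_nonneg (μ := μ) (s := (openConn x y ∩ (openConn y z)ᶜ : Set (BondConfig (Fin n))))]

/-- **Harris for the two decreasing events `D_a`, `D`**: `μ(D_a)·μ(D) ≤ μ(N)`. [folklore] -/
theorem s2red_harris_N (w : Sym2 (Fin n) → unitInterval) (x y z : Fin n) :
    (prodBernoulli w).real ((openConn x y)ᶜ ∩ (openConn x z)ᶜ) * (prodBernoulli w).real (openConn y z)ᶜ ≤
      (prodBernoulli w).real ((openConn x y)ᶜ ∩ (openConn x z)ᶜ ∩ (openConn y z)ᶜ) := by
  have hA : IsLowerSet ((openConn x y)ᶜ ∩ (openConn x z)ᶜ : Set (BondConfig (Fin n))) :=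
    (isUpperSet_openConn x y).compl.inter (isUpperSet_openConn x z).compl
  have hB : IsLowerSet ((openConn y z)ᶜ : Set (BondConfig (Fin n))) := (isUpperSet_openConn y z).compl
  exact prodBernoulli_harris_lower w hA hB MeasurableSet.of_discrete MeasurableSet.of_discrete

/-- **S2 from S2_M.**  If `μ({o↔x} ∩ N)·τ({x↔y}) ≤ μ(N)·τ({o↔y})` (the sharp-constant form S2_M) then
`μ(W)·σ₂({x↔y}) ≤ μ(D_a)·σ₂({o↔y})` (the registered `stub_exchS2`), where `σ₂(Q) = τ(Q)` after expanding
the complements.  Proof: multiply the goal by `μ(N)`; `μ(N)·μ(D_a)·τ(oy) ≥ μ(D_a)·μ(ox∩N)·τ(xy) ≥ μ(W)·μ(N)·τ(xy)`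
by S2_M, `τ(xy) ≥ 0` and `θ ≤ θ_M`; if `μ(N) = 0` then `μ(D_a)μ(D) = 0` (Harris) and both sides vanish.
[cite: KozmaNitzan2024, Question 7 (p. 36)] -/
theorem exchS2_of_s2M (w : Sym2 (Fin n) → unitInterval) (o b x y z : Fin n) (hyz : y ≠ z)
    (hS2M : (prodBernoulli w).real (openConn o x ∩ ((openConn x y)ᶜ ∩ (openConn x z)ᶜ ∩ (openConn y z)ᶜ)) *
        ((prodBernoulli w).real (openConn y z)ᶜ *
            (prodBernoulli w).real (openConn x y ∩ (openConn z b)ᶜ ∩ (openConn y z)ᶜ) -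
          (prodBernoulli w).real (openConn x y ∩ (openConn y z)ᶜ) *
            (prodBernoulli w).real ((openConn z b)ᶜ ∩ (openConn y z)ᶜ)) ≤
      (prodBernoulli w).real ((openConn x y)ᶜ ∩ (openConn x z)ᶜ ∩ (openConn y z)ᶜ) *
        ((prodBernoulli w).real (openConn y z)ᶜ *
            (prodBernoulli w).real (openConn o y ∩ (openConn z b)ᶜ ∩ (openConn y z)ᶜ) -
          (prodBernoulli w).real (openConn o y ∩ (openConn y z)ᶜ) *
            (prodBernoulli w).real ((openConn z b)ᶜ ∩ (openConn y z)ᶜ))) :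
    (prodBernoulli w).real (((openConn x y)ᶜ ∩ (openConn x z)ᶜ) ∩ openConn o x) *
        ((prodBernoulli w).real (openConn x y ∩ (openConn y z)ᶜ) *
            (prodBernoulli w).real (openConn z b ∩ (openConn y z)ᶜ) -
          (prodBernoulli w).real (openConn y z)ᶜ *
            (prodBernoulli w).real (openConn x y ∩ openConn z b ∩ (openConn y z)ᶜ)) ≤
      (prodBernoulli w).real ((openConn x y)ᶜ ∩ (openConn x z)ᶜ) *
        ((prodBernoulli w).real (openConn o y ∩ (openConn y z)ᶜ) *
            (prodBernoulli w).real (openConn z b ∩ (openConn y z)ᶜ) -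
          (prodBernoulli w).real (openConn y z)ᶜ *
            (prodBernoulli w).real (openConn o y ∩ openConn z b ∩ (openConn y z)ᶜ)) := by
  set μ := prodBernoulli w with hμ
  have hm : ∀ s : Set (BondConfig (Fin n)), MeasurableSet s := fun _ => MeasurableSet.of_discrete
  -- abbreviations
  set A := μ.real (((openConn x y)ᶜ ∩ (openConn x z)ᶜ) ∩ openConn o x : Set (BondConfig (Fin n))) with hA
  set Da := μ.real ((openConn x y)ᶜ ∩ (openConn x z)ᶜ : Set (BondConfig (Fin n))) with hDa
  set Nn := μ.real ((openConn x y)ᶜ ∩ (openConn x z)ᶜ ∩ (openConn y z)ᶜ : Set (BondConfig (Fin n))) with hNn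
  set oxN := μ.real (openConn o x ∩ ((openConn x y)ᶜ ∩ (openConn x z)ᶜ ∩ (openConn y z)ᶜ) : Set (BondConfig (Fin n)))
    with hoxN
  set d := μ.real ((openConn y z)ᶜ : Set (BondConfig (Fin n))) with hd
  set qx := μ.real (openConn x y ∩ (openConn y z)ᶜ : Set (BondConfig (Fin n))) with hqx
  set qxz := μ.real (openConn x y ∩ (openConn z b)ᶜ ∩ (openConn y z)ᶜ : Set (BondConfig (Fin n))) with hqxz
  set qo := μ.real (openConn o y ∩ (openConn y z)ᶜ : Set (BondConfig (Fin n))) with hqo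
  set qoz := μ.real (openConn o y ∩ (openConn z b)ᶜ ∩ (openConn y z)ᶜ : Set (BondConfig (Fin n))) with hqoz
  set zc := μ.real ((openConn z b)ᶜ ∩ (openConn y z)ᶜ : Set (BondConfig (Fin n))) with hzc
  set zo := μ.real (openConn z b ∩ (openConn y z)ᶜ : Set (BondConfig (Fin n))) with hzo
  set qxo := μ.real (openConn x y ∩ openConn z b ∩ (openConn y z)ᶜ : Set (BondConfig (Fin n))) with hqxo
  set qoo := μ.real (openConn o y ∩ openConn z b ∩ (openConn y z)ᶜ : Set (BondConfig (Fin n))) with hqoo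
  -- complement identities: zo + zc = d, qxo + qxz = qx, qoo + qoz = qo
  have c1 : zo + zc = d := by
    have h := measureReal_inter_add_sdiff (μ := μ) (s := ((openConn y z)ᶜ : Set (BondConfig (Fin n))))
      (t := openConn z b) (hm _)
    have hs1 : ((openConn y z)ᶜ : Set (BondConfig (Fin n))) ∩ openConn z b = openConn z b ∩ (openConn y z)ᶜ :=
      inter_comm _ _
    have hs2 : ((openConn y z)ᶜ : Set (BondConfig (Fin n))) \ openConn z b = (openConn z b)ᶜ ∩ (openConn y z)ᶜ := by
      ext ω; simp only [mem_sdiff, mem_compl_iff, mem_inter_iff]; tauto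
    rw [hs1, hs2] at h; exact h
  have c2 : qxo + qxz = qx := by
    have h := measureReal_inter_add_sdiff (μ := μ) (s := (openConn x y ∩ (openConn y z)ᶜ : Set (BondConfig (Fin n))))
      (t := openConn z b) (hm _)
    have hs1 : (openConn x y ∩ (openConn y z)ᶜ : Set (BondConfig (Fin n))) ∩ openConn z b =
        openConn x y ∩ openConn z b ∩ (openConn y z)ᶜ := by
      ext ω; simp only [mem_inter_iff, mem_compl_iff]; tauto
    have hs2 : (openConn x y ∩ (openConn y z)ᶜ : Set (BondConfig (Fin n))) \ openConn z b =
        openConn x y ∩ (openConn z b)ᶜ ∩ (openConn y z)ᶜ := by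
      ext ω; simp only [mem_sdiff, mem_inter_iff, mem_compl_iff]; tauto
    rw [hs1, hs2] at h; exact h
  have c3 : qoo + qoz = qo := by
    have h := measureReal_inter_add_sdiff (μ := μ) (s := (openConn o y ∩ (openConn y z)ᶜ : Set (BondConfig (Fin n))))
      (t := openConn z b) (hm _)
    have hs1 : (openConn o y ∩ (openConn y z)ᶜ : Set (BondConfig (Fin n))) ∩ openConn z b =
        openConn o y ∩ openConn z b ∩ (openConn y z)ᶜ := by
      ext ω; simp only [mem_inter_iff, mem_compl_iff]; tauto
    have hs2 : (openConn o y ∩ (openConn y z)ᶜ : Set (BondConfig (Fin n))) \ openConn z b =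
        openConn o y ∩ (openConn z b)ᶜ ∩ (openConn y z)ᶜ := by
      ext ω; simp only [mem_sdiff, mem_inter_iff, mem_compl_iff]; tauto
    rw [hs1, hs2] at h; exact h
  -- the three inputs
  have htilt : A * Nn ≤ oxN * Da := s2red_theta_le_thetaM w o x y z
  have htau : qx * zc ≤ d * qxz := s2red_tau_nonneg w b x y z hyz
  have hhar : Da * d ≤ Nn := s2red_harris_N w x y z
  -- nonnegativity / monotonicity facts
  have hA_le : A ≤ Da := by
    rw [hA, hDa]; exact measureReal_mono inter_subset_left
  have hA0 : 0 ≤ A := measureReal_nonneg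
  have hDa0 : 0 ≤ Da := measureReal_nonneg
  have hN0 : 0 ≤ Nn := measureReal_nonneg
  have hox0 : 0 ≤ oxN := measureReal_nonneg
  have hd0 : 0 ≤ d := measureReal_nonneg
  have hqx_le : qx ≤ d := by rw [hqx, hd]; exact measureReal_mono inter_subset_right
  have hqo_le : qo ≤ d := by rw [hqo, hd]; exact measureReal_mono inter_subset_right
  have hqxz_le : qxz ≤ d := by rw [hqxz, hd]; exact measureReal_mono inter_subset_right
  have hqoz_le : qoz ≤ d := by rw [hqoz, hd]; exact measureReal_mono inter_subset_right
  have hzc_le : zc ≤ d := by rw [hzc, hd]; exact measureReal_mono inter_subset_right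
  have hqx0 : 0 ≤ qx := measureReal_nonneg
  have hqo0 : 0 ≤ qo := measureReal_nonneg
  have hqxz0 : 0 ≤ qxz := measureReal_nonneg
  have hqoz0 : 0 ≤ qoz := measureReal_nonneg
  have hzc0 : 0 ≤ zc := measureReal_nonneg
  -- rewrite the goal in terms of τ
  have goal_eq : A * (qx * zo - d * qxo) - Da * (qo * zo - d * qoo) =
      A * (d * qxz - qx * zc) - Da * (d * qoz - qo * zc) := by
    have hzo : zo = d - zc := by linarith
    have hqxo' : qxo = qx - qxz := by linarith
    have hqoo' : qoo = qo - qoz := by linarith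
    rw [hzo, hqxo', hqoo']; ring
  -- S2_M in the abbreviations
  have hS : oxN * (d * qxz - qx * zc) ≤ Nn * (d * qoz - qo * zc) := hS2M
  -- main inequality multiplied by μ(N)
  have key : Nn * (A * (d * qxz - qx * zc)) ≤ Nn * (Da * (d * qoz - qo * zc)) := by
    have htau' : 0 ≤ d * qxz - qx * zc := by linarith
    nlinarith [mul_le_mul_of_nonneg_right htilt htau', mul_le_mul_of_nonneg_left hS hDa0]
  suffices h : A * (d * qxz - qx * zc) ≤ Da * (d * qoz - qo * zc) by linarith [goal_eq]
  by_cases hN : Nn = 0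
  · -- degenerate case: μ(D_a)·μ(D) = 0
    have hprod : Da * d = 0 := le_antisymm (by simpa [hN] using hhar) (mul_nonneg hDa0 hd0)
    rcases mul_eq_zero.1 hprod with hDa_z | hd_z
    · have hA_z : A = 0 := le_antisymm (by simpa [hDa_z] using hA_le) hA0
      rw [hA_z, hDa_z]; simp
    · have hqx_z : qx = 0 := le_antisymm (by simpa [hd_z] using hqx_le) hqx0
      have hqo_z : qo = 0 := le_antisymm (by simpa [hd_z] using hqo_le) hqo0
      have hqxz_z : qxz = 0 := le_antisymm (by simpa [hd_z] using hqxz_le) hqxz0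
      have hqoz_z : qoz = 0 := le_antisymm (by simpa [hd_z] using hqoz_le) hqoz0
      rw [hd_z, hqx_z, hqo_z, hqxz_z, hqoz_z]; simp
  · have hNpos : 0 < Nn := lt_of_le_of_ne hN0 (Ne.symm hN)
    exact le_of_mul_le_mul_left key hNpos

/-- **Registered-signature form of the reduction**: the registered sharp residual `stub_s2M` implies the
registered stub `stub_exchS2` (both quantified over all graphs and vertices). [cite: KozmaNitzan2024, Question 7 (p. 36)] -/
theorem stub_exchS2_of_stub_s2M
    (hS2M : ∀ (n : ℕ) (w : Sym2 (Fin n) → unitInterval) (o b x y z : Fin n), x ≠ y → x ≠ z → y ≠ z → (Literature.Probability.LatticeModels.prodBernoulli w).real (Literature.Probability.Percolation.openConn o x ∩ ((Literature.Probability.Percolation.openConn x y)ᶜ ∩ (Literature.Probability.Percolation.openConn x z)ᶜ ∩ (Literature.Probability.Percolation.openConn y z)ᶜ)) * ((Literature.Probability.LatticeModels.prodBernoulli w).real (Literature.Probability.Percolation.openConn y z)ᶜ * (Literature.Probability.LatticeModels.prodBernoulli w).real (Literature.Probability.Percolation.openConn x y ∩ (Literature.Probability.Percolation.openConn z b)ᶜ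 ∩ (Literature.Probability.Percolation.openConn y z)ᶜ) - (Literature.Probability.LatticeModels.prodBernoulli w).real (Literature.Probability.Percolation.openConn x y ∩ (Literature.Probability.Percolation.openConn y z)ᶜ) * (Literature.Probability.LatticeModels.prodBernoulli w).real ((Literature.Probability.Percolation.openConn z b)ᶜ ∩ (Literature.Probability.Percolation.openConn y z)ᶜ)) ≤ (Literature.Probability.LatticeModels.prodBernoulli w).real ((Literature.Probability.Percolation.openConn x y)ᶜ ∩ (Literature.Probability.Percolation.openConn x z)ᶜ ∩ (Literature.Probability.Percolation.openConn y z)ᶜ) * ((Literature.Probability.LatticeModels.prodBernoulli w).real (Literature.Probability.Percolation.openConn y z)ᶜ * (Literature.Probability.LatticeModels.prodBernoulli w).real (Literature.Probability.Percolation.openConn o y ∩ (Literature.Probability.Percolation.openConn z b)ᶜ ∩ (Literature.Probability.Percolation.openConn y z)ᶜ) - (Literature.Probability.LatticeModels.prodBernoulli w).real (Literature.Probability.Percolation.openConn o y ∩ (Literature.Probability.Percolation.openConn y z)ᶜ) * (Literature.Probability.LatticeModels.prodBernoulli w).real ((Literature.Probability.Percolation.openConn z b)ᶜ ∩ (Literature.Probability.Percolation.openConn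 y z)ᶜ)))
    (w : Sym2 (Fin n) → unitInterval) (o b x y z : Fin n) (hxy : x ≠ y) (hxz : x ≠ z) (hyz : y ≠ z) :
    (prodBernoulli w).real (((openConn x y)ᶜ ∩ (openConn x z)ᶜ) ∩ openConn o x) *
        ((prodBernoulli w).real (openConn x y ∩ (openConn y z)ᶜ) *
            (prodBernoulli w).real (openConn z b ∩ (openConn y z)ᶜ) -
          (prodBernoulli w).real (openConn y z)ᶜ *
            (prodBernoulli w).real (openConn x y ∩ openConn z b ∩ (openConn y z)ᶜ)) ≤
      (prodBernoulli w).real ((openConn x y)ᶜ ∩ (openConn x z)ᶜ) *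
        ((prodBernoulli w).real (openConn o y ∩ (openConn y z)ᶜ) *
            (prodBernoulli w).real (openConn z b ∩ (openConn y z)ᶜ) -
          (prodBernoulli w).real (openConn y z)ᶜ *
            (prodBernoulli w).real (openConn o y ∩ openConn z b ∩ (openConn y z)ᶜ)) :=
  exchS2_of_s2M w o b x y z hyz (hS2M n w o b x y z hxy hxz hyz)

/-- **Registered reduction stub** `stub_exchS2OfS2M`: for every graph and all `o b x y z` with `x, y, z`
distinct, the sharp-constant inequality S2_M implies the exchange slack inequality S2 (pointwise form of
`exchS2_of_s2M`). [cite: KozmaNitzan2024, Question 7 (p. 36)] -/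
theorem stub_exchS2OfS2M : ∀ (n : ℕ) (w : Sym2 (Fin n) → unitInterval) (o b x y z : Fin n), x ≠ y → x ≠ z → y ≠ z → ((Literature.Probability.LatticeModels.prodBernoulli w).real (Literature.Probability.Percolation.openConn o x ∩ ((Literature.Probability.Percolation.openConn x y)ᶜ ∩ (Literature.Probability.Percolation.openConn x z)ᶜ ∩ (Literature.Probability.Percolation.openConn y z)ᶜ)) * ((Literature.Probability.LatticeModels.prodBernoulli w).real (Literature.Probability.Percolation.openConn y z)ᶜ * (Literature.Probability.LatticeModels.prodBernoulli w).real (Literature.Probability.Percolation.openConn x y ∩ (Literature.Probability.Percolation.openConn z b)ᶜ ∩ (Literature.Probability.Percolation.openConn y z)ᶜ) - (Literature.Probability.LatticeModels.prodBernoulli w).real (Literature.Probability.Percolation.openConn x y ∩ (Literature.Probability.Percolation.openConn y z)ᶜ) * (Literature.Probability.LatticeModels.prodBernoulli w).real ((Literature.Probability.Percolation.openConn z b)ᶜ ∩ (Literature.Probability.Percolation.openConn y z)ᶜ)) ≤ (Literature.Probability.LatticeModels.prodBernoulli w).real ((Literature.Probability.Percolation.openConn x y)ᶜ ∩ (Literature.Probability.Percolation.openConn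 x z)ᶜ ∩ (Literature.Probability.Percolation.openConn y z)ᶜ) * ((Literature.Probability.LatticeModels.prodBernoulli w).real (Literature.Probability.Percolation.openConn y z)ᶜ * (Literature.Probability.LatticeModels.prodBernoulli w).real (Literature.Probability.Percolation.openConn o y ∩ (Literature.Probability.Percolation.openConn z b)ᶜ ∩ (Literature.Probability.Percolation.openConn y z)ᶜ) - (Literature.Probability.LatticeModels.prodBernoulli w).real (Literature.Probability.Percolation.openConn o y ∩ (Literature.Probability.Percolation.openConn y z)ᶜ) * (Literature.Probability.LatticeModels.prodBernoulli w).real ((Literature.Probability.Percolation.openConn z b)ᶜ ∩ (Literature.Probability.Percolation.openConn y z)ᶜ))) → (Literature.Probability.LatticeModels.prodBernoulli w).real (((Literature.Probability.Percolation.openConn x y)ᶜ ∩ (Literature.Probability.Percolation.openConn x z)ᶜ) ∩ Literature.Probability.Percolation.openConn o x) * ((Literature.Probability.LatticeModels.prodBernoulli w).real (Literature.Probability.Percolation.openConn x y ∩ (Literature.Probability.Percolation.openConn y z)ᶜ) * (Literature.Probability.LatticeModels.prodBernoulli w).real (Literature.Probability.Percolation.openConn z b ∩ (Literature.Probability.Percolation.openConn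 y z)ᶜ) - (Literature.Probability.LatticeModels.prodBernoulli w).real (Literature.Probability.Percolation.openConn y z)ᶜ * (Literature.Probability.LatticeModels.prodBernoulli w).real (Literature.Probability.Percolation.openConn x y ∩ Literature.Probability.Percolation.openConn z b ∩ (Literature.Probability.Percolation.openConn y z)ᶜ)) ≤ (Literature.Probability.LatticeModels.prodBernoulli w).real ((Literature.Probability.Percolation.openConn x y)ᶜ ∩ (Literature.Probability.Percolation.openConn x z)ᶜ) * ((Literature.Probability.LatticeModels.prodBernoulli w).real (Literature.Probability.Percolation.openConn o y ∩ (Literature.Probability.Percolation.openConn y z)ᶜ) * (Literature.Probability.LatticeModels.prodBernoulli w).real (Literature.Probability.Percolation.openConn z b ∩ (Literature.Probability.Percolation.openConn y z)ᶜ) - (Literature.Probability.LatticeModels.prodBernoulli w).real (Literature.Probability.Percolation.openConn y z)ᶜ * (Literature.Probability.LatticeModels.prodBernoulli w).real (Literature.Probability.Percolation.openConn o y ∩ Literature.Probability.Percolation.openConn z b ∩ (Literature.Probability.Percolation.openConn y z)ᶜ)) :=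
  fun _ w o b x y z _ _ hyz hS2M => exchS2_of_s2M w o b x y z hyz hS2M

end

end Summit.CriticalPhenomena.PercolationContinuityZ3.Theorems
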